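import Literature.MathematicalPhysics.QuantumFieldTheory.ConformalBootstrap3D.RadialTableParity
import HarnessLib

/-!
# The radial expansion of a parity-supported table as a double power series in `(ρ, ρ̄)`

Hogervorst–Rychkov 2013 §3 (eqs. (3.4)–(3.6)) and Costa–Hansen–Penedones–Trevisani 2016 §2.1
(eqs. (2.11), (2.15)) expand a (prefactored) conformal block radially,
`𝒢̃ = 4^Δ Σ_{m,j} w(m,j) r^{Δ+m} P_j(η)`, with spins `j ≤ ℓ + m` and `j ≡ ℓ + m (mod 2)` at level `m`.
In the tree the regrouping of such a series into a double power series is done in the square-root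
coordinates `(s,u) = (√ρ, √ρ̄)` (`radialMonArr`, `hasSum_radialMonArr`, no parity used). WITH the parity
condition (`ParitySupport`, derived for typed blocks in `RadialTableParity`) every monomial has even
degrees in `s` and in `u`: a level-`m` spin-`j` term is `(ρρ̄)^{(Δ-ℓ)/2}` times a homogeneous polynomial
of degree `ℓ + m` in `(ρ, ρ̄)` with INTEGER exponents and non-negative coefficients `λ_i λ_k`
(HR13 eq. (3.6)). This file records that integer-coordinate form:

* `radialIntArr ℓ d (a,b) := radialMonArr ℓ d (2a, 2b)` and the vanishing of `radialMonArr` at odd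
  degrees under `ParitySupport` (`ParitySupport.radialMonArr_eq_zero_of_odd`);
* `hasSum_radialIntArr_of_hasSum_zMono` — for `ρ, ρ̄ > 0`, a convergent supported parity-supported radial series
  `Σ d(m,j) 𝒫_{Δ+m,j}(ρ,ρ̄) = S` regroups as `Σ_{a,b} radialIntArr(a,b) ρ^a ρ̄^b = (ρρ̄)^{-(Δ-ℓ)/2} S`;
* `summable_abs_radialIntArr_of_summable` — if the radial series converges at every point of the open square then
  `Σ |radialIntArr(a,b)| r^a t^b < ∞` for all `0 ≤ r, t < 1` (domination by the series of `|d|`);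
* `radialIntArr_signed` — the level-signed table `(-1)^m d(m,j)` has integer array
  `(-1)^{ℓ+a+b} radialIntArr(a,b)` (the sign of Dolan–Osborn's `x₁ ↔ x₂` relation, `ρ ↦ -ρ`);
* `HasRadialExpansion.hasSum_radialIntArr` — the hypothesis `HasRadialExpansion c Δ w g` in this form.

These are the inputs of the one-variable analytic continuation in `BlockSignedRadialExpansion`.
No named fact is introduced; nothing is asserted about typed blocks.

Sources: M. Hogervorst, S. Rychkov, Phys. Rev. D 87 (2013) 106004, arXiv:1303.1111, §3 eqs. (3.4)–(3.6);
M. S. Costa, T. Hansen, J. Penedones, E. Trevisani, JHEP 07 (2016) 057, arXiv:1603.05552, §2.1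
eqs. (2.11), (2.15). Tree: `radialMonArr`, `hasSum_radialMonArr`, `abs_radialMonArr_le`,
`radialArr_eq_zero_of_parity`, `ParitySupport`, `RadialSupport`, `zOfRho`, `rhoOf_zOfRho`.
-/

namespace Literature.MathematicalPhysics.QuantumFieldTheory.ConformalBootstrap3D

open Finset Set

/-! ### Parity-supported tables: the monomial array lives on even degrees -/

/-- The absolute value of a parity-supported table is parity-supported (API of the parity selection
rule). [cite: HogervorstRychkov2013, §2.1 eq. (2.15)] -/
theorem ParitySupport.abs {ℓ : ℕ} {d : ℕ × ℕ → ℝ} (hd : ParitySupport ℓ d) :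
    ParitySupport ℓ (fun q => |d q|) := fun q hq => by
  simp only [hd q hq, abs_zero]

/-- A parity-supported table times any weight is parity-supported (API of the parity selection rule).
[cite: HogervorstRychkov2013, §2.1 eq. (2.15)] -/
theorem ParitySupport.mul_left {ℓ : ℕ} {d : ℕ × ℕ → ℝ} (hd : ParitySupport ℓ d) (c : ℕ × ℕ → ℝ) :
    ParitySupport ℓ (fun q => c q * d q) := fun q hq => by
  simp only [hd q hq, mul_zero]

/-- The `(√ρ,√ρ̄)`-monomial array vanishes at odd total degree (by definition: a radial term of level `m`
is homogeneous of degree `2(ℓ+m)` in `(√ρ,√ρ̄)`). [cite: HogervorstRychkov2013, §3 eq. (3.6)] -/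
theorem radialMonArr_eq_zero_of_odd_sum (ℓ : ℕ) (d : ℕ × ℕ → ℝ) {p : ℕ × ℕ}
    (h : (p.1 + p.2) % 2 = 1) : radialMonArr ℓ d p = 0 := by
  unfold radialMonArr
  rw [if_neg]
  rintro ⟨h0, -⟩
  omega

/-- **Under the parity condition the monomial array has no odd `√ρ`-degree**: for a table with
`d(m,j) = 0` unless `j ≡ ℓ + m (mod 2)`, `radialMonArr ℓ d (a,b) = 0` whenever `a` is odd (each spin-`j`
term of level `m` contributes only degrees `a ≡ ℓ + m - j ≡ 0`; Hogervorst–Rychkov 2013 eq. (3.6) with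
the selection rule after eq. (3.3)). [cite: HogervorstRychkov2013, §3 eq. (3.6)] -/
theorem ParitySupport.radialMonArr_eq_zero_of_odd {ℓ : ℕ} {d : ℕ × ℕ → ℝ} (hd : ParitySupport ℓ d)
    {p : ℕ × ℕ} (h1 : p.1 % 2 = 1) : radialMonArr ℓ d p = 0 := by
  obtain ⟨a, b⟩ := p
  simp only at h1
  by_cases hg : (a + b) % 2 = 0 ∧ 2 * ℓ ≤ a + b
  · obtain ⟨m, hm⟩ : ∃ m, a + b = 2 * (ℓ + m) := ⟨(a + b) / 2 - ℓ, by omega⟩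
    have hp : (a, b) ∈ antidiagonal (2 * (ℓ + m)) := by rw [mem_antidiagonal]; exact hm
    rw [radialMonArr_of_mem d hp]
    refine sum_eq_zero fun j hj => ?_
    by_cases hpar : (ℓ + (m, j).1 + (m, j).2) % 2 = 1
    · rw [hd (m, j) hpar, zero_mul]
    · have hj' := Finset.mem_range.mp hj
      simp only at hpar
      rw [radialArr_eq_zero_of_parity (by omega), mul_zero]
  · unfold radialMonArr
    rw [if_neg hg]

/-! ### The integer-coordinate array -/

/-- The `(ρ,ρ̄)`-monomial coefficient array of a radial series with table `d` and base spin `ℓ`, in INTEGER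
exponents: `radialIntArr ℓ d (a,b) := radialMonArr ℓ d (2a,2b)`, the coefficient of `ρ^a ρ̄^b` in
`(ρρ̄)^{-(Δ-ℓ)/2} Σ_{m,j} d(m,j) 𝒫_{Δ+m,j}(ρ,ρ̄)` — meaningful for parity-supported tables, where all
other entries of `radialMonArr` vanish. (Hogervorst–Rychkov 2013 eq. (3.6): `r^j P_j(η) =
Σ_{i+k=j} λ_iλ_k ρ^i ρ̄^k`.) [cite: HogervorstRychkov2013, §3 eq. (3.6)] -/
noncomputable def radialIntArr (ℓ : ℕ) (d : ℕ × ℕ → ℝ) (q : ℕ × ℕ) : ℝ :=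
  radialMonArr ℓ d (2 * q.1, 2 * q.2)

/-- `radialIntArr` unfolded. [cite: HogervorstRychkov2013, §3 eq. (3.6)] -/
theorem radialIntArr_def (ℓ : ℕ) (d : ℕ × ℕ → ℝ) (q : ℕ × ℕ) :
    radialIntArr ℓ d q = radialMonArr ℓ d (2 * q.1, 2 * q.2) := rfl

/-- `|radialIntArr ℓ d| ≤ radialIntArr ℓ |d|` entrywise (the coefficients `λ_iλ_k` of eq. (3.6) are
non-negative). [cite: HogervorstRychkov2013, §3 eq. (3.6)] -/
theorem abs_radialIntArr_le (ℓ : ℕ) (d : ℕ × ℕ → ℝ) (q : ℕ × ℕ) :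
    |radialIntArr ℓ d q| ≤ radialIntArr ℓ (fun p => |d p|) q :=
  abs_radialMonArr_le ℓ d _

/-- The integer array of a table of absolute values is non-negative (`λ_iλ_k ≥ 0` in eq. (3.6)).
[cite: HogervorstRychkov2013, §3 eq. (3.6)] -/
theorem radialIntArr_abs_nonneg (ℓ : ℕ) (d : ℕ × ℕ → ℝ) (q : ℕ × ℕ) :
    0 ≤ radialIntArr ℓ (fun p => |d p|) q :=
  (abs_nonneg _).trans (abs_radialIntArr_le ℓ d q)

/-- Linearity of the integer array in the table (scalars). [cite: HogervorstRychkov2013, §3 eq. (3.6)] -/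
theorem radialIntArr_smul (ℓ : ℕ) (κ : ℝ) (d : ℕ × ℕ → ℝ) (q : ℕ × ℕ) :
    radialIntArr ℓ (fun p => κ * d p) q = κ * radialIntArr ℓ d q :=
  radialMonArr_smul ℓ κ d _

/-- **The level sign is a monomial sign.** The integer array of the level-signed table `(-1)^m d(m,j)`
is `(-1)^{ℓ+a+b}` times that of `d`: a level-`m` term only produces monomials `ρ^a ρ̄^b` with
`a + b = ℓ + m` (this is why Dolan–Osborn's `x₁ ↔ x₂` relation, `ρ ↦ -ρ`, turns the radial expansion of
the `⟨εσσε⟩` block into the SIGNED expansion of the `⟨σεσε⟩` block).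
[cite: DolanOsborn2011, §2 eq. (2.23)] -/
theorem radialIntArr_signed (ℓ : ℕ) (d : ℕ × ℕ → ℝ) (q : ℕ × ℕ) :
    radialIntArr ℓ (fun p => (-1 : ℝ) ^ p.1 * d p) q =
      (-1 : ℝ) ^ (ℓ + q.1 + q.2) * radialIntArr ℓ d q := by
  obtain ⟨a, b⟩ := q
  unfold radialIntArr radialMonArr
  simp only
  split_ifs with hg
  · have hm : (2 * a + 2 * b) / 2 - ℓ = a + b - ℓ := by omega
    rw [hm, mul_sum]
    refine sum_congr rfl fun j _ => ?_
    have hsign : (-1 : ℝ) ^ (a + b - ℓ) = (-1) ^ (ℓ + a + b) := by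
      have h2 : ℓ + a + b = (a + b - ℓ) + 2 * ℓ := by omega
      rw [h2, pow_add, pow_mul]
      norm_num
    rw [hsign]
    ring
  · rw [mul_zero]

/-- **Reindexing to even degrees.** For a parity-supported table the `(s,u)`-monomial family
`radialMonArr ℓ d (a,b) s^a u^b` and the integer family `radialIntArr ℓ d (a,b) (s²)^a (u²)^b` have the
same sums (the former vanishes off the even degrees). [cite: HogervorstRychkov2013, §3 eq. (3.6)] -/
theorem ParitySupport.hasSum_radialIntArr_iff {ℓ : ℕ} {d : ℕ × ℕ → ℝ} (hd : ParitySupport ℓ d)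
    (s u S : ℝ) :
    HasSum (fun q : ℕ × ℕ => radialIntArr ℓ d q * (s ^ 2) ^ q.1 * (u ^ 2) ^ q.2) S ↔
      HasSum (fun p : ℕ × ℕ => radialMonArr ℓ d p * s ^ p.1 * u ^ p.2) S := by
  set e : ℕ × ℕ → ℕ × ℕ := fun q => (2 * q.1, 2 * q.2) with he
  have hinj : Function.Injective e := fun q q' h => by
    simp only [he, Prod.mk.injEq] at h
    exact Prod.ext (by omega) (by omega)
  have hoff : ∀ p ∉ Set.range e, radialMonArr ℓ d p * s ^ p.1 * u ^ p.2 = 0 := by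
    intro p hp
    by_cases h1 : p.1 % 2 = 1
    · rw [hd.radialMonArr_eq_zero_of_odd h1, zero_mul, zero_mul]
    · by_cases h2 : p.2 % 2 = 1
      · rw [radialMonArr_eq_zero_of_odd_sum ℓ d (by omega), zero_mul, zero_mul]
      · exfalso
        exact hp ⟨(p.1 / 2, p.2 / 2), Prod.ext (by simp only [he]; omega) (by simp only [he]; omega)⟩
  have hfun : (fun q : ℕ × ℕ => radialIntArr ℓ d q * (s ^ 2) ^ q.1 * (u ^ 2) ^ q.2) =
      (fun p : ℕ × ℕ => radialMonArr ℓ d p * s ^ p.1 * u ^ p.2) ∘ e := by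
    funext q
    simp only [Function.comp_apply, he, radialIntArr, ← pow_mul]
  rw [hfun]
  exact hinj.hasSum_iff hoff

/-- **Regrouping in integer coordinates.** If `d` is supported on `j ≤ ℓ + m`, parity-supported, and
`Σ_{(m,j)} d(m,j) 𝒫_{Δ+m,j}(ρ,ρ̄) = S` converges (unconditionally) at a point `ρ, ρ̄ > 0`, then
`Σ_{(a,b)} radialIntArr ℓ d (a,b) ρ^a ρ̄^b = (ρρ̄)^{-(Δ-ℓ)/2} S` as a double series.
(Hogervorst–Rychkov 2013 §3 eqs. (3.4)–(3.6).) [cite: HogervorstRychkov2013, §3 eqs. (3.4)–(3.6)] -/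
theorem hasSum_radialIntArr_of_hasSum_zMono {ℓ : ℕ} {d : ℕ × ℕ → ℝ} (hd : RadialSupport ℓ d) (hp : ParitySupport ℓ d)
    {Δ ρ ρb S : ℝ} (hρ : 0 < ρ) (hρb : 0 < ρb)
    (h : HasSum (fun q : ℕ × ℕ => d q * zMono (Δ + (q.1 : ℝ)) q.2 ρ ρb) S) :
    HasSum (fun q : ℕ × ℕ => radialIntArr ℓ d q * ρ ^ q.1 * ρb ^ q.2)
      ((ρ * ρb) ^ (-((Δ - (ℓ : ℝ)) / 2)) * S) := by
  set s := Real.sqrt ρ with hs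
  set u := Real.sqrt ρb with hu
  have hs0 : 0 < s := Real.sqrt_pos.mpr hρ
  have hu0 : 0 < u := Real.sqrt_pos.mpr hρb
  have hs2 : s ^ 2 = ρ := Real.sq_sqrt hρ.le
  have hu2 : u ^ 2 = ρb := Real.sq_sqrt hρb.le
  have h' : HasSum (fun q : ℕ × ℕ => d q * zMono (Δ + (q.1 : ℝ)) q.2 (s ^ 2) (u ^ 2)) S := by
    rwa [hs2, hu2]
  have H := hasSum_radialMonArr hd hs0 hu0 h'
  rw [← hp.hasSum_radialIntArr_iff, hs2, hu2] at H
  have hsu : (s * u) ^ (-(Δ - (ℓ : ℝ))) = (ρ * ρb) ^ (-((Δ - (ℓ : ℝ)) / 2)) := by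
    rw [hs, hu, ← Real.sqrt_mul hρ.le, Real.sqrt_eq_rpow, ← Real.rpow_mul (mul_pos hρ hρb).le]
    congr 1
    ring
  rwa [hsu] at H

/-- **Absolute summability of the integer array on the open unit square.** If the supported,
parity-supported radial series `Σ d(m,j) 𝒫_{Δ+m,j}(ρ,ρ̄)` converges at every point of the open square
`(0,1)²`, then `Σ_{(a,b)} |radialIntArr ℓ d (a,b)| r^a t^b < ∞` for all `0 ≤ r, t < 1` (dominate by the
regrouped series of `|d|` at `(max r ½, max t ½)`). [cite: HogervorstRychkov2013, §3 eqs. (3.4)–(3.6)] -/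
theorem summable_abs_radialIntArr_of_summable {ℓ : ℕ} {d : ℕ × ℕ → ℝ} (hd : RadialSupport ℓ d)
    (hp : ParitySupport ℓ d) {Δ : ℝ}
    (hsum : ∀ ρ ρb : ℝ, 0 < ρ → ρ < 1 → 0 < ρb → ρb < 1 →
      Summable (fun q : ℕ × ℕ => d q * zMono (Δ + (q.1 : ℝ)) q.2 ρ ρb))
    {r t : ℝ} (hr0 : 0 ≤ r) (hr1 : r < 1) (ht0 : 0 ≤ t) (ht1 : t < 1) :
    Summable (fun q : ℕ × ℕ => |radialIntArr ℓ d q| * r ^ q.1 * t ^ q.2) := by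
  set r' := max r (1 / 2) with hr'
  set t' := max t (1 / 2) with ht'
  have hr'0 : 0 < r' := lt_max_of_lt_right (by norm_num)
  have hr'1 : r' < 1 := max_lt hr1 (by norm_num)
  have ht'0 : 0 < t' := lt_max_of_lt_right (by norm_num)
  have ht'1 : t' < 1 := max_lt ht1 (by norm_num)
  have hS := hsum r' t' hr'0 hr'1 ht'0 ht'1
  have habs : HasSum (fun q : ℕ × ℕ => |d q| * zMono (Δ + (q.1 : ℝ)) q.2 r' t')
      (∑' q : ℕ × ℕ, |d q * zMono (Δ + (q.1 : ℝ)) q.2 r' t'|) := by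
    refine hS.abs.hasSum.congr_fun fun q => ?_
    rw [abs_mul, abs_of_nonneg (zMono_nonneg _ _ hr'0.le ht'0.le)]
  have H := hasSum_radialIntArr_of_hasSum_zMono hd.abs hp.abs hr'0 ht'0 habs
  refine Summable.of_nonneg_of_le (fun q => by positivity) (fun q => ?_) H.summable
  have h1 : |radialIntArr ℓ d q| ≤ radialIntArr ℓ (fun p => |d p|) q := abs_radialIntArr_le ℓ d q
  have h0 : 0 ≤ radialIntArr ℓ (fun p => |d p|) q := radialIntArr_abs_nonneg ℓ d q
  have hrr : r ≤ r' := le_max_left _ _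
  have htt : t ≤ t' := le_max_left _ _
  have h2 : r ^ q.1 ≤ r' ^ q.1 := pow_le_pow_left₀ hr0 hrr _
  have h3 : t ^ q.2 ≤ t' ^ q.2 := pow_le_pow_left₀ ht0 htt _
  calc |radialIntArr ℓ d q| * r ^ q.1 * t ^ q.2
      ≤ radialIntArr ℓ (fun p => |d p|) q * r' ^ q.1 * t' ^ q.2 :=
        mul_le_mul (mul_le_mul h1 h2 (pow_nonneg hr0 _) h0) h3 (pow_nonneg ht0 _)
          (mul_nonneg h0 (pow_nonneg hr'0.le _))
    _ = _ := rfl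

/-! ### The radial expansion hypothesis in integer coordinates -/

/-- `HasRadialExpansion c Δ w g` read at the point `(z(ρ), z(ρ̄))` of the square: for `ρ, ρ̄ ∈ (0,1)`,
`Σ 4^Δ w(m,j) 𝒫_{Δ+m,j}(ρ,ρ̄) = ((1-z(ρ))(1-z(ρ̄)))^c g(z(ρ), z(ρ̄))`.
[cite: CostaHansenPenedonesTrevisani2016, §2.1 eq. (2.11)] -/
theorem HasRadialExpansion.hasSum_zMono {c Δ : ℝ} {w : ℕ × ℕ → ℝ} {g : ℝ → ℝ → ℝ}
    (h : HasRadialExpansion c Δ w g) {ρ ρb : ℝ} (hρ0 : 0 < ρ) (hρ1 : ρ < 1) (hρb0 : 0 < ρb)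
    (hρb1 : ρb < 1) :
    HasSum (fun q : ℕ × ℕ => ((4 : ℝ) ^ Δ * w q) * zMono (Δ + (q.1 : ℝ)) q.2 ρ ρb)
      (((1 - zOfRho ρ) * (1 - zOfRho ρb)) ^ c * g (zOfRho ρ) (zOfRho ρb)) := by
  have hX : zOfRho ρ ∈ Ioo (0 : ℝ) 1 := ⟨zOfRho_pos hρ0, zOfRho_lt_one (by linarith) hρ1.ne⟩
  have hY : zOfRho ρb ∈ Ioo (0 : ℝ) 1 := ⟨zOfRho_pos hρb0, zOfRho_lt_one (by linarith) hρb1.ne⟩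
  refine (h _ _ hX hY).congr_fun fun q => ?_
  simp only [radialMono, rhoOf_zOfRho (by linarith : (-1 : ℝ) < ρ) hρ1.le,
    rhoOf_zOfRho (by linarith : (-1 : ℝ) < ρb) hρb1.le]

/-- **The radial expansion as a double power series in `(ρ,ρ̄)`.** Under `HasRadialExpansion c Δ w g`
with `w` supported on `j ≤ ℓ + m` and parity-supported, for `ρ, ρ̄ ∈ (0,1)`:
`Σ_{(a,b)} radialIntArr ℓ (4^Δ w) (a,b) ρ^a ρ̄^b = (ρρ̄)^{-(Δ-ℓ)/2} ((1-z)(1-z̄))^c g(z,z̄)`,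
`z = z(ρ)`, `z̄ = z(ρ̄)`. [cite: CostaHansenPenedonesTrevisani2016, §2.1 eqs. (2.11), (2.15)] -/
theorem HasRadialExpansion.hasSum_radialIntArr {c Δ : ℝ} {ℓ : ℕ} {w : ℕ × ℕ → ℝ} {g : ℝ → ℝ → ℝ}
    (h : HasRadialExpansion c Δ w g) (hw : RadialSupport ℓ w) (hp : ParitySupport ℓ w) {ρ ρb : ℝ}
    (hρ0 : 0 < ρ) (hρ1 : ρ < 1) (hρb0 : 0 < ρb) (hρb1 : ρb < 1) :
    HasSum (fun q : ℕ × ℕ => radialIntArr ℓ (fun p => (4 : ℝ) ^ Δ * w p) q * ρ ^ q.1 * ρb ^ q.2)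
      ((ρ * ρb) ^ (-((Δ - (ℓ : ℝ)) / 2)) *
        (((1 - zOfRho ρ) * (1 - zOfRho ρb)) ^ c * g (zOfRho ρ) (zOfRho ρb))) :=
  hasSum_radialIntArr_of_hasSum_zMono (hw.mul_left _) (hp.mul_left _) hρ0 hρb0
    (h.hasSum_zMono hρ0 hρ1 hρb0 hρb1)

/-- **Absolute summability on the unit square from the radial expansion hypothesis.**
[cite: CostaHansenPenedonesTrevisani2016, §2.1 eqs. (2.11), (2.15)] -/
theorem HasRadialExpansion.summable_abs_radialIntArr {c Δ : ℝ} {ℓ : ℕ} {w : ℕ × ℕ → ℝ}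
    {g : ℝ → ℝ → ℝ} (h : HasRadialExpansion c Δ w g) (hw : RadialSupport ℓ w)
    (hp : ParitySupport ℓ w) {r t : ℝ} (hr0 : 0 ≤ r) (hr1 : r < 1) (ht0 : 0 ≤ t) (ht1 : t < 1) :
    Summable (fun q : ℕ × ℕ =>
      |radialIntArr ℓ (fun p => (4 : ℝ) ^ Δ * w p) q| * r ^ q.1 * t ^ q.2) :=
  summable_abs_radialIntArr_of_summable (hw.mul_left _) (hp.mul_left _)
    (fun _ _ hρ0 hρ1 hρb0 hρb1 => (h.hasSum_zMono hρ0 hρ1 hρb0 hρb1).summable) hr0 hr1 ht0 ht1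

end Literature.MathematicalPhysics.QuantumFieldTheory.ConformalBootstrap3D
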